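import Summits.Ventures.PercRepro.C025ProfileThinGirthB

/-!
# THE ROW `(q, q+1)` ON THIN MATROIDS WITH A `g`-CIRCUIT — part C: (Cap) (night-3 g15)
The `g`-circuit generalisation of `C025ProfileThinTriangleC` (parts A, B = `C025ProfileThinGirthA/B`). The capacity side for an ABSTRACT
weight `w` with type weights `a, b : ℕ → ℚ` (`a t` on `B ∪ {x}` with `x ∉ C₀`, `b t` with `x ∈ C₀`, `t = |B ∩ C₀|`): `cap_succ`
(`|S| = q + 1`: the loaders `S ∖ {c}` carry `s b(s−1) + (q + 1 − s) a(s)`, `s = |S ∩ C₀| ≤ g − 1`), `cap_Q` (`|S| = q + 2 ⊇ C₀`: at most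
`q + 2 − g` loaders `S ∖ {c}` paying `≤ 1`, at most `g (q + 2 − g)` top-type loaders paying `s_Q`, the rest `0`), `cap_extra`
(`|S| = q + 2 ⊉ C₀`: at most `g − 1` coloops, the σ-loaders inject into `col S × (S ∖ col S)`, load `≤ c + c (q + 2 − c) σ`), and
`ThinTriangle.cap_big` is reused as it stands. `C₀` is written `K` below (`|K| = g`, `ρ(K) + 1 = g`).
-/
open scoped Matroid
namespace PercRepro
open Set Finset ThmH Staged
namespace ThinGirth
variable {α : Type} [DecidableEq α] {M : Matroid α} [M.Finite]


/-- **(Cap), `|S| = q + 1`**: the loaders are the sets `S ∖ {c}`, `c ∈ S`, paying `b (s − 1)` for `c ∈ C₀` and `a s` for `c ∉ C₀`, where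
`s = |S ∩ C₀| ≤ g − 1` (`C₀ ⊄ S` since `ρ(S) = q + 1 = |S|`): the load is `s b(s−1) + (q + 1 − s) a(s)`. -/
theorem cap_succ {q g : ℕ} {K : Finset α} (hK3 : K.card = g) (hKrk : rkN M K + 1 = g)
    (w : Finset α → Finset α → ℚ) (hw_nonneg : ∀ B S, 0 ≤ w B S) (a b : ℕ → ℚ)
    (hw_in : ∀ B S : Finset α, B.card = q → S.card = q + 1 → (S ∩ K).card = (B ∩ K).card + 1 → (S ∩ K).card + 1 ≤ g →
      w B S = b (B ∩ K).card)
    (hw_out : ∀ B S : Finset α, B.card = q → S.card = q + 1 → (S ∩ K).card = (B ∩ K).card → w B S = a (B ∩ K).card)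
    (hcap : ∀ s : ℕ, s + 1 ≤ g → (s : ℚ) * b (s - 1) + ((q + 1 - s : ℕ) : ℚ) * a s ≤ q + 1)
    {S : Finset α} (hSc : S.card = q + 1) (hS : rkN M S = q + 1) :
    ∑ B ∈ (Profile.Rq M q).filter (fun B => B ⊆ S), w B S ≤ (q : ℚ) + 1 := by
  have hKS : ¬ K ⊆ S := fun h => by have := rkN_add_one_le_card_of_subset hK3 hKrk h; omega
  have hsub : (Profile.Rq M q).filter (fun B => B ⊆ S) ⊆ S.image (fun c => S.erase c) := by
    intro B hB
    rw [Finset.mem_filter, Profile.mem_Rq] at hB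
    obtain ⟨⟨_, hBr⟩, hBS⟩ := hB
    have hBq : rkN M B = q := rkN_eq_iff.mpr hBr
    have hBc : B.card = q := by
      have h1 : q ≤ B.card := hBq ▸ rkN_le_card B
      have h2 : B.card ≤ q + 1 := hSc ▸ Finset.card_le_card hBS
      rcases Nat.lt_or_ge B.card (q + 1) with hlt | hge
      · omega
      · exfalso
        have : B = S := Finset.eq_of_subset_of_card_le hBS (by omega)
        rw [this] at hBq
        omega
    exact OneCircuit.powersetCard_pred_subset_image hSc (Finset.mem_powersetCard.mpr ⟨hBS, hBc⟩)
  have hsum : ∑ B ∈ (Profile.Rq M q).filter (fun B => B ⊆ S), w B S ≤ ∑ c ∈ S, w (S.erase c) S :=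
    (Finset.sum_le_sum_of_subset_of_nonneg hsub (fun B _ _ => hw_nonneg B S)).trans
      (le_of_eq (Finset.sum_image (Finset.erase_injOn S)))
  have hm : (S ∩ K).card ≤ g := (Finset.card_le_card Finset.inter_subset_right).trans hK3.le
  have hmg : (S ∩ K).card ≠ g := fun h => hKS ((subset_iff_card_inter_eq hK3).mpr h)
  have hce : ∀ c ∈ S, (S.erase c).card = q := fun c hc => by rw [Finset.card_erase_of_mem hc, hSc]; omega
  have hSK : (S \ K).card + (S ∩ K).card = S.card := Finset.card_sdiff_add_card_inter S K
  have heval : ∀ c ∈ S, w (S.erase c) S = if c ∈ K then b ((S ∩ K).card - 1) else a (S ∩ K).card := by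
    intro c hc
    have hi := OneCircuit.card_erase_inter S K hc
    split_ifs with hcK
    · rw [if_pos hcK] at hi
      have hpos : 1 ≤ (S ∩ K).card := Finset.card_pos.mpr ⟨c, Finset.mem_inter.mpr ⟨hc, hcK⟩⟩
      rw [hw_in _ _ (hce c hc) hSc (by rw [hi]; omega) (by omega), hi]
    · rw [if_neg hcK] at hi
      rw [hw_out _ _ (hce c hc) hSc hi.symm, hi]
  rw [Finset.sum_congr rfl heval, OneCircuit.sum_ite_mem_eq] at hsum
  have hq' : (S \ K).card = q + 1 - (S ∩ K).card := by omega
  rw [hq'] at hsum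
  have := hcap (S ∩ K).card (by omega)
  linarith

/-- **(Cap), `|S| = q + 2`, `C₀ ⊆ S`**: the `(q+1)`-loaders are the `q + 2 − g` sets `S ∖ {c}`, `c ∉ C₀` (`≤ 1` each); the `q`-loaders with
`g − 1` points of `C₀` (at most `g (q + 2 − g)`, the sets `S ∖ {k, c}`) pay `s_Q`; a `q`-loader with `g − 2` points of `C₀` has no inner
point in `S` (its two missing points are in `C₀`, and `S ∖ {c}` has rank `q + 1` for `c ∈ C₀`) and pays `0`; the load is
`≤ (q + 2 − g) + g (q + 2 − g) s_Q`. -/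
theorem cap_Q {q g : ℕ} (hgirth : ∀ X ⊆ gr M, X.card + 1 ≤ g → rkN M X = X.card)
    (hthin : ∀ X ⊆ gr M, rkN M X = q → X.card ≤ q + 1)
    {K : Finset α} (hKg : K ⊆ gr M) (hK3 : K.card = g) (hKrk : rkN M K + 1 = g)
    (w : Finset α → Finset α → ℚ) (sQ σ : ℚ) (hsQ : 0 ≤ sQ)
    (hw_a1 : ∀ B S : Finset α, B.card = q + 1 → S.card = q + 2 → w B S ≤ 1)
    (hw_2Q : ∀ B S : Finset α, B.card = q → (B ∩ K).card + 1 = g → S.card = q + 2 → (S ∩ K).card = g → w B S = sQ)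
    (hw_q_small : ∀ B S : Finset α, B.card = q → (B ∩ K).card + 2 ≤ g → S.card = q + 2 →
      w B S ≤ if (∃ y ∈ S \ B, rkN M (insert y B) = q) then σ else 0)
    (hcapQ : ((q + 2 - g : ℕ) : ℚ) + ((g * (q + 2 - g) : ℕ) : ℚ) * sQ ≤ q + 1)
    {S : Finset α} (hSc : S.card = q + 2) (hS : rkN M S = q + 1) (hKS : K ⊆ S) :
    ∑ B ∈ (Profile.Rq M q).filter (fun B => B ⊆ S), w B S ≤ (q : ℚ) + 1 := by
  have hSK : (S ∩ K).card = g := (subset_iff_card_inter_eq hK3).mp hKS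
  have hSdK : (S \ K).card = q + 2 - g := by rw [Finset.card_sdiff_of_subset hKS, hSc, hK3]
  -- the pointwise bound on the loaders
  have hpt : ∀ B ∈ (Profile.Rq M q).filter (fun B => B ⊆ S),
      w B S ≤ (if B.card = q + 1 then (1 : ℚ) else 0) + (if B.card = q ∧ (B ∩ K).card + 1 = g then sQ else 0) := by
    intro B hB
    rw [Finset.mem_filter, Profile.mem_Rq] at hB
    obtain ⟨⟨hBg, hBr⟩, hBS⟩ := hB
    have hBq : rkN M B = q := rkN_eq_iff.mpr hBr
    rcases ThinTriangle.card_eq_or_eq_of_rkN_eq hthin hBg hBq with hBc | hBc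
    · rw [if_neg (by omega)]
      have hm : (B ∩ K).card ≤ g := (Finset.card_le_card Finset.inter_subset_right).trans hK3.le
      have hKBsub : K \ B ⊆ S \ B := fun z hz =>
        Finset.mem_sdiff.mpr ⟨hKS (Finset.mem_sdiff.mp hz).1, (Finset.mem_sdiff.mp hz).2⟩
      have hSB : (S \ B).card = 2 := by rw [Finset.card_sdiff_of_subset hBS]; omega
      have hKB : (K \ B).card + (B ∩ K).card = g := by
        have := OneCircuit.card_sdiff_add_card_inter' K B; omega
      have hKB2 : (K \ B).card ≤ 2 := by have := Finset.card_le_card hKBsub; omega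
      rcases (by omega : (B ∩ K).card + 2 = g ∨ (B ∩ K).card + 1 = g ∨ (B ∩ K).card = g) with h1 | h2 | h3
      · rw [if_neg (by omega)]
        have hw := hw_q_small B S hBc (by omega) hSc
        rw [if_neg ?_] at hw
        · linarith
        · rintro ⟨y, hy, hyr⟩
          have hySB := Finset.mem_sdiff.mp hy
          have hEq : K \ B = S \ B := Finset.eq_of_subset_of_card_le hKBsub (by omega)
          have hc1 : ((S \ B).erase y).card = 1 := by rw [Finset.card_erase_of_mem hy, hSB]
          obtain ⟨c, hc⟩ := Finset.card_eq_one.mp hc1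
          have hcmem : c ∈ (S \ B).erase y := hc ▸ Finset.mem_singleton_self c
          have hcS : c ∈ S := (Finset.mem_sdiff.mp (Finset.mem_of_mem_erase hcmem)).1
          have hcB : c ∉ B := (Finset.mem_sdiff.mp (Finset.mem_of_mem_erase hcmem)).2
          have hcK : c ∈ K := by
            have : c ∈ K \ B := hEq ▸ Finset.mem_sdiff.mpr ⟨hcS, hcB⟩
            exact (Finset.mem_sdiff.mp this).1
          have hSc' : S.erase c = insert y B := by
            apply Finset.eq_of_subset_of_card_le
            · intro z hz
              rw [Finset.mem_erase] at hz
              rw [Finset.mem_insert]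
              by_cases hzB : z ∈ B
              · right; exact hzB
              · left
                by_contra hzy
                have : z ∈ (S \ B).erase y := Finset.mem_erase.mpr ⟨hzy, Finset.mem_sdiff.mpr ⟨hz.2, hzB⟩⟩
                rw [hc, Finset.mem_singleton] at this
                exact hz.1 this
            · have := Finset.card_erase_of_mem hcS
              rw [Finset.card_insert_of_notMem hySB.2]
              omega
          have := rkN_erase_eq_succ_of_mem hgirth hKg hK3 hKrk hKS hS hcK
          rw [hSc', hyr] at this
          omega
      · rw [if_pos ⟨hBc, h2⟩, hw_2Q B S hBc h2 hSc hSK]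
        simp
      · exfalso
        have hKB : K ⊆ B := (subset_iff_card_inter_eq hK3).mpr h3
        have := rkN_add_one_le_card_of_subset hK3 hKrk hKB
        omega
    · rw [if_pos hBc, if_neg (by omega)]
      have := hw_a1 B S hBc hSc
      linarith
  have hsum := Finset.sum_le_sum hpt
  rw [Finset.sum_add_distrib] at hsum
  -- the `(q+1)`-loaders: at most `q + 2 − g` of them
  have hA : ∑ B ∈ (Profile.Rq M q).filter (fun B => B ⊆ S), (if B.card = q + 1 then (1 : ℚ) else 0) ≤
      ((q + 2 - g : ℕ) : ℚ) := by
    rw [Finset.sum_ite, Finset.sum_const_zero, add_zero, Finset.sum_const, nsmul_eq_mul, mul_one]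
    have himg : ((Profile.Rq M q).filter (fun B => B ⊆ S)).filter (fun B => B.card = q + 1) ⊆
        (S \ K).image (fun c => S.erase c) := by
      intro B hB
      rw [Finset.mem_filter, Finset.mem_filter, Profile.mem_Rq] at hB
      obtain ⟨⟨⟨_, hBr⟩, hBS⟩, hBc⟩ := hB
      have hBq : rkN M B = q := rkN_eq_iff.mpr hBr
      have hSB : (S \ B).card = 1 := by rw [Finset.card_sdiff_of_subset hBS]; omega
      obtain ⟨c, hc⟩ := Finset.card_eq_one.mp hSB
      have hcmem : c ∈ S \ B := hc ▸ Finset.mem_singleton_self c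
      have hcS : c ∈ S := (Finset.mem_sdiff.mp hcmem).1
      have hcB : c ∉ B := (Finset.mem_sdiff.mp hcmem).2
      have hBeq : B = S.erase c := by
        apply Finset.eq_of_subset_of_card_le
        · intro z hz; exact Finset.mem_erase.mpr ⟨fun h => hcB (h ▸ hz), hBS hz⟩
        · have := Finset.card_erase_of_mem hcS; omega
      have hcK : c ∉ K := by
        intro hcK
        have := rkN_erase_eq_succ_of_mem hgirth hKg hK3 hKrk hKS hS hcK
        rw [← hBeq] at this
        omega
      rw [Finset.mem_image]
      exact ⟨c, Finset.mem_sdiff.mpr ⟨hcS, hcK⟩, hBeq.symm⟩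
    have h1 := Finset.card_le_card himg
    have h2 : ((S \ K).image (fun c => S.erase c)).card ≤ (S \ K).card := Finset.card_image_le
    have h3 : (((Profile.Rq M q).filter (fun B => B ⊆ S)).filter (fun B => B.card = q + 1)).card ≤ q + 2 - g := by
      omega
    exact_mod_cast h3
  -- the top-type loaders: at most `g (q + 2 − g)` of them
  have hB2 : ∑ B ∈ (Profile.Rq M q).filter (fun B => B ⊆ S),
      (if B.card = q ∧ (B ∩ K).card + 1 = g then sQ else 0) ≤ ((g * (q + 2 - g) : ℕ) : ℚ) * sQ := by
    rw [Finset.sum_ite, Finset.sum_const_zero, add_zero, Finset.sum_const, nsmul_eq_mul]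
    apply mul_le_mul_of_nonneg_right _ hsQ
    have hcount : (((Profile.Rq M q).filter (fun B => B ⊆ S)).filter
        (fun B => B.card = q ∧ (B ∩ K).card + 1 = g)).card ≤ g * (q + 2 - g) := by
      have himg : ((Profile.Rq M q).filter (fun B => B ⊆ S)).filter (fun B => B.card = q ∧ (B ∩ K).card + 1 = g) ⊆
          (K ×ˢ (S \ K)).image (fun p => (S.erase p.1).erase p.2) := by
        intro B hB
        rw [Finset.mem_filter, Finset.mem_filter] at hB
        obtain ⟨⟨_, hBS⟩, hBc, hB2⟩ := hB
        have hKB : (K \ B).card = 1 := by have := OneCircuit.card_sdiff_add_card_inter' K B; omega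
        obtain ⟨k, hk⟩ := Finset.card_eq_one.mp hKB
        have hkK : k ∈ K := (Finset.mem_sdiff.mp (hk ▸ Finset.mem_singleton_self k)).1
        have hkB : k ∉ B := (Finset.mem_sdiff.mp (hk ▸ Finset.mem_singleton_self k)).2
        have hSB : (S \ B).card = 2 := by rw [Finset.card_sdiff_of_subset hBS]; omega
        have hSBK : ((S \ B) ∩ K).card = 1 := by
          have heq : (S \ B) ∩ K = K \ B := by
            ext x
            simp only [Finset.mem_inter, Finset.mem_sdiff]
            constructor
            · rintro ⟨⟨_, hxB⟩, hxK⟩; exact ⟨hxK, hxB⟩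
            · rintro ⟨hxK, hxB⟩; exact ⟨⟨hKS hxK, hxB⟩, hxK⟩
          rw [heq, hKB]
        have hSBK' : ((S \ B) \ K).card = 1 := by have := Finset.card_sdiff_add_card_inter (S \ B) K; omega
        obtain ⟨c, hc⟩ := Finset.card_eq_one.mp hSBK'
        have hcmem : c ∈ (S \ B) \ K := hc ▸ Finset.mem_singleton_self c
        have hcS : c ∈ S := (Finset.mem_sdiff.mp (Finset.mem_sdiff.mp hcmem).1).1
        have hcB : c ∉ B := (Finset.mem_sdiff.mp (Finset.mem_sdiff.mp hcmem).1).2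
        have hcK : c ∉ K := (Finset.mem_sdiff.mp hcmem).2
        have hkc : k ≠ c := fun h => hcK (h ▸ hkK)
        have hpair : S \ B = {k, c} := by
          symm
          apply Finset.eq_of_subset_of_card_le
          · intro x hx
            rw [Finset.mem_insert, Finset.mem_singleton] at hx
            rcases hx with rfl | rfl
            · exact Finset.mem_sdiff.mpr ⟨hKS hkK, hkB⟩
            · exact Finset.mem_sdiff.mpr ⟨hcS, hcB⟩
          · rw [Finset.card_pair hkc]; omega
        rw [Finset.mem_image]
        refine ⟨(k, c), Finset.mem_product.mpr ⟨hkK, Finset.mem_sdiff.mpr ⟨hcS, hcK⟩⟩, ?_⟩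
        apply Finset.eq_of_subset_of_card_le
        · intro x hx
          rw [Finset.mem_erase, Finset.mem_erase] at hx
          by_contra hxB
          have : x ∈ S \ B := Finset.mem_sdiff.mpr ⟨hx.2.2, hxB⟩
          rw [hpair, Finset.mem_insert, Finset.mem_singleton] at this
          rcases this with h | h
          · exact hx.2.1 h
          · exact hx.1 h
        · rw [Finset.card_erase_of_mem (Finset.mem_erase.mpr ⟨hkc.symm, hcS⟩),
            Finset.card_erase_of_mem (hKS hkK), hSc, hBc]
          omega
      calc (((Profile.Rq M q).filter (fun B => B ⊆ S)).filter (fun B => B.card = q ∧ (B ∩ K).card + 1 = g)).card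
          ≤ ((K ×ˢ (S \ K)).image (fun p => (S.erase p.1).erase p.2)).card := Finset.card_le_card himg
        _ ≤ (K ×ˢ (S \ K)).card := Finset.card_image_le
        _ = g * (q + 2 - g) := by rw [Finset.card_product, hK3, hSdK]
    exact_mod_cast hcount
  linarith

/-- **(Cap), `|S| = q + 2`, `C₀ ⊄ S`**: with `c = |col S| ≤ g − 1` coloops (`card_col_le`), the `(q+1)`-loaders are the sets `S ∖ {x}`,
`x ∈ col S` (`≤ 1` each), the top-type loaders pay `0` (`|S ∩ C₀| ≠ g`), and the σ-loaders inject into `col S × (S ∖ col S)`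
(`ThinTriangle.mem_image_of_inner`): load `≤ c + c (q + 2 − c) σ ≤ q + 1` by the hypothesis `hcapiii`. -/
theorem cap_extra {q g : ℕ} (hgirth : ∀ X ⊆ gr M, X.card + 1 ≤ g → rkN M X = X.card)
    (hthin : ∀ X ⊆ gr M, rkN M X = q → X.card ≤ q + 1)
    {K : Finset α} (hKg : K ⊆ gr M) (hK3 : K.card = g) (hKrk : rkN M K + 1 = g)
    (w : Finset α → Finset α → ℚ) (σ : ℚ) (hσ : 0 ≤ σ)
    (hcapiii : ∀ c : ℕ, c + 1 ≤ g → (c : ℚ) + ((c * (q + 2 - c) : ℕ) : ℚ) * σ ≤ q + 1)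
    (hw_a1 : ∀ B S : Finset α, B.card = q + 1 → S.card = q + 2 → w B S ≤ 1)
    (hw_2Q0 : ∀ B S : Finset α, B.card = q → (B ∩ K).card + 1 = g → S.card = q + 2 → (S ∩ K).card ≠ g → w B S = 0)
    (hw_q_small : ∀ B S : Finset α, B.card = q → (B ∩ K).card + 2 ≤ g → S.card = q + 2 →
      w B S ≤ if (∃ y ∈ S \ B, rkN M (insert y B) = q) then σ else 0)
    {S : Finset α} (hSg : S ⊆ gr M) (hSc : S.card = q + 2) (hS : rkN M S = q + 1) (hKS : ¬ K ⊆ S) :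
    ∑ B ∈ (Profile.Rq M q).filter (fun B => B ⊆ S), w B S ≤ (q : ℚ) + 1 := by
  have hSKg : (S ∩ K).card ≠ g := fun h => hKS ((subset_iff_card_inter_eq hK3).mpr h)
  have hcol : (S.filter (fun c => rkN M (S.erase c) = q)).card + 1 ≤ g :=
    card_col_le hgirth hthin hKg hK3 hKrk hSg hSc hS hKS
  have hcolS : S.filter (fun c => rkN M (S.erase c) = q) ⊆ S := Finset.filter_subset _ _
  have hScol : (S \ S.filter (fun c => rkN M (S.erase c) = q)).card =
      q + 2 - (S.filter (fun c => rkN M (S.erase c) = q)).card := by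
    rw [Finset.card_sdiff_of_subset hcolS, hSc]
  -- the pointwise bound on the loaders
  have hpt : ∀ B ∈ (Profile.Rq M q).filter (fun B => B ⊆ S),
      w B S ≤ (if B.card = q + 1 then (1 : ℚ) else 0) +
        (if (B.card = q ∧ ∃ y ∈ S \ B, rkN M (insert y B) = q) then σ else 0) := by
    intro B hB
    rw [Finset.mem_filter, Profile.mem_Rq] at hB
    obtain ⟨⟨hBg, hBr⟩, hBS⟩ := hB
    have hBq : rkN M B = q := rkN_eq_iff.mpr hBr
    rcases ThinTriangle.card_eq_or_eq_of_rkN_eq hthin hBg hBq with hBc | hBc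
    · rw [if_neg (by omega)]
      have hm : (B ∩ K).card ≤ g := (Finset.card_le_card Finset.inter_subset_right).trans hK3.le
      rcases (by omega : (B ∩ K).card + 2 ≤ g ∨ (B ∩ K).card + 1 = g ∨ (B ∩ K).card = g) with h1 | h2 | h3
      · have hw := hw_q_small B S hBc h1 hSc
        by_cases hex : ∃ y ∈ S \ B, rkN M (insert y B) = q
        · rw [if_pos hex] at hw
          rw [if_pos ⟨hBc, hex⟩]
          linarith
        · rw [if_neg hex] at hw
          rw [if_neg (fun h => hex h.2)]
          linarith
      · rw [hw_2Q0 B S hBc h2 hSc hSKg]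
        split_ifs <;> linarith
      · exfalso
        have hKB : K ⊆ B := (subset_iff_card_inter_eq hK3).mpr h3
        have := rkN_add_one_le_card_of_subset hK3 hKrk hKB
        omega
    · rw [if_pos hBc, if_neg (by omega)]
      have := hw_a1 B S hBc hSc
      linarith
  have hsum := Finset.sum_le_sum hpt
  rw [Finset.sum_add_distrib] at hsum
  -- the `(q+1)`-loaders are the sets `S ∖ {c}` with `c ∈ col S`
  have hA : ∑ B ∈ (Profile.Rq M q).filter (fun B => B ⊆ S), (if B.card = q + 1 then (1 : ℚ) else 0) ≤
      ((S.filter (fun c => rkN M (S.erase c) = q)).card : ℚ) := by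
    rw [Finset.sum_ite, Finset.sum_const_zero, add_zero, Finset.sum_const, nsmul_eq_mul, mul_one]
    have himg : ((Profile.Rq M q).filter (fun B => B ⊆ S)).filter (fun B => B.card = q + 1) ⊆
        (S.filter (fun c => rkN M (S.erase c) = q)).image (fun c => S.erase c) := by
      intro B hB
      rw [Finset.mem_filter, Finset.mem_filter, Profile.mem_Rq] at hB
      obtain ⟨⟨⟨_, hBr⟩, hBS⟩, hBc⟩ := hB
      have hBq : rkN M B = q := rkN_eq_iff.mpr hBr
      have hSB : (S \ B).card = 1 := by rw [Finset.card_sdiff_of_subset hBS]; omega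
      obtain ⟨c, hc⟩ := Finset.card_eq_one.mp hSB
      have hcmem : c ∈ S \ B := hc ▸ Finset.mem_singleton_self c
      have hcS : c ∈ S := (Finset.mem_sdiff.mp hcmem).1
      have hcB : c ∉ B := (Finset.mem_sdiff.mp hcmem).2
      have hBeq : B = S.erase c := by
        apply Finset.eq_of_subset_of_card_le
        · intro z hz; exact Finset.mem_erase.mpr ⟨fun h => hcB (h ▸ hz), hBS hz⟩
        · have := Finset.card_erase_of_mem hcS; omega
      rw [Finset.mem_image]
      exact ⟨c, Finset.mem_filter.mpr ⟨hcS, by rw [← hBeq]; exact hBq⟩, hBeq.symm⟩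
    have h1 := Finset.card_le_card himg
    have h2 : ((S.filter (fun c => rkN M (S.erase c) = q)).image (fun c => S.erase c)).card ≤
        (S.filter (fun c => rkN M (S.erase c) = q)).card := Finset.card_image_le
    exact_mod_cast h1.trans h2
  -- the σ-loaders inject into `col S × (S ∖ col S)`
  have hB2 : ∑ B ∈ (Profile.Rq M q).filter (fun B => B ⊆ S),
      (if (B.card = q ∧ ∃ y ∈ S \ B, rkN M (insert y B) = q) then σ else 0) ≤
      (((S.filter (fun c => rkN M (S.erase c) = q)).card *
        (q + 2 - (S.filter (fun c => rkN M (S.erase c) = q)).card) : ℕ) : ℚ) * σ := by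
    rw [Finset.sum_ite, Finset.sum_const_zero, add_zero, Finset.sum_const, nsmul_eq_mul]
    apply mul_le_mul_of_nonneg_right _ hσ
    have himg : ((Profile.Rq M q).filter (fun B => B ⊆ S)).filter
        (fun B => B.card = q ∧ ∃ y ∈ S \ B, rkN M (insert y B) = q) ⊆
        ((S.filter (fun c => rkN M (S.erase c) = q)) ×ˢ (S \ S.filter (fun c => rkN M (S.erase c) = q))).image
          (fun p => (S.erase p.1).erase p.2) := by
      intro B hB
      rw [Finset.mem_filter, Finset.mem_filter, Profile.mem_Rq] at hB
      obtain ⟨⟨⟨_, hBr⟩, hBS⟩, hBc, y, hy, hyr⟩ := hB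
      have hBq : rkN M B = q := rkN_eq_iff.mpr hBr
      exact ThinTriangle.mem_image_of_inner hSc hS hBS hBc hBq (Finset.mem_sdiff.mp hy).1 (Finset.mem_sdiff.mp hy).2 hyr
    have h1 := Finset.card_le_card himg
    have h2 := Finset.card_image_le (s := (S.filter (fun c => rkN M (S.erase c) = q)) ×ˢ
      (S \ S.filter (fun c => rkN M (S.erase c) = q))) (f := fun p : α × α => (S.erase p.1).erase p.2)
    rw [Finset.card_product, hScol] at h2
    exact_mod_cast h1.trans h2
  have := hcapiii (S.filter (fun c => rkN M (S.erase c) = q)).card hcol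
  linarith

end ThinGirth
end PercRepro
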